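import Summits.Ventures.PercRepro2.CaseOneA2EdgeQ
import Summits.Ventures.PercRepro2.CaseOneA2EdgeIB
import Summits.Ventures.PercRepro2.CaseOnePendantPath

/-!
# The `(i-Q)` form along an `a₂a₃`-edge under the threshold domination, and the four forms (blind
cell PercRepro2, p1 g30; the mirror of `CaseOneA2EdgeQ.lean`; the `b ∈ C₁`-side coefficients are in
`CaseOneA2EdgeIB.lean`)

The `(i)`-type form at an `o`-pair `c` and a `b ∈ C₁`-pair `y` is
`Λᴵ(c, y) = −c₁ (y₁ R₃ − y₀ P₃) + c₀ (y₁ R₂ − y₀ P₁)`; here `Bᴵ(y) = y₁ R₂ − y₀ P₁ ≥ 0` (BHK 1.3,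
**`bhk13_cleared`**) — the same quantity at the forced-open `b ∈ C₁`-pair, because
`R₁ = R₀ − R₂` and `X₁ = X₀ − P₁` exactly (**`bhk13_forced_open`**) — so a larger `o`-threshold can
only help, exactly as on the `(ii)` side: **`lamQI_c1_nonneg`** (the forced-open `o`-pair dominates
the PD pair of `G − e₂`), **`lamQI_c1_nonneg_ofQ`** (it dominates the Q pair), **`lamQI_c0_y1_nonneg`**
(`(i-Q)(G − e₂)`, the `b ∈ C₁`-threshold can only drop, `odds_q`), **`zSplitIQ_of_a2_edge`**, and
**`fourForms_of_a2_edge`**: under either domination the four forms of `G − e₂` give the four forms of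
`G`. The domination is a HYPOTHESIS that fails on rare instances (proofs/P1-G30.md §2′): this is the
transfer on the generic instances, not the `a₂`-edge rule for `ClosedAt`. Own code; standard
axioms. -/

namespace Summit.Ventures.PercRepro2

namespace CaseOne

section IQ
variable {V : Type*} {E : Type*} [Fintype E] [DecidableEq E] [Fintype V] [DecidableEq V]
  {R : Type*} [Field R] [LinearOrder R] [IsStrictOrderedRing R]
variable {ends : E → Sym2 V} {a₁ a₂ a₃ : V} {e₂ : E}

omit [Fintype V] [DecidableEq V] in
/-- **The forced-open `o`-pair dominates in every `(i)`-type form, given ODDS-3E.** -/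
theorem lamQI_c1_nonneg (p : E → R) (hp : IsProbVec p) (he : ends e₂ = s(a₂, a₃)) (o b : V)
    (hodds : Dpdo (Function.update p e₂ 0) ends o a₁ a₂ a₃ *
        prob (Function.update p e₂ 1) (connEvent ends a₁ a₂)ᶜ ≤
      Dqo (Function.update p e₂ 1) ends o a₁ a₂ * Dpd (Function.update p e₂ 0) ends a₁ a₂ a₃)
    (y₀ y₁ : R)
    (hB : 0 ≤ y₁ * prob (Function.update p e₂ 0) (connEvent ends a₁ b ∩ connEvent ends a₁ a₃ ∩
        (connEvent ends a₁ a₂)ᶜ) -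
      y₀ * prob (Function.update p e₂ 0) (connEvent ends a₁ a₃ ∩ (connEvent ends a₁ a₂)ᶜ))
    (hΛ : 0 ≤ -(Dpd (Function.update p e₂ 0) ends a₁ a₂ a₃ *
        (y₁ * prob (Function.update p e₂ 0) (connEvent ends a₁ b ∩ connEvent ends a₁ a₃ ∩
            connEvent ends a₂ o ∩ (connEvent ends a₁ a₂)ᶜ) -
          y₀ * prob (Function.update p e₂ 0) (connEvent ends a₁ a₃ ∩ connEvent ends a₂ o ∩
            (connEvent ends a₁ a₂)ᶜ))) +
        Dpdo (Function.update p e₂ 0) ends o a₁ a₂ a₃ *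
        (y₁ * prob (Function.update p e₂ 0) (connEvent ends a₁ b ∩ connEvent ends a₁ a₃ ∩
            (connEvent ends a₁ a₂)ᶜ) -
          y₀ * prob (Function.update p e₂ 0) (connEvent ends a₁ a₃ ∩ (connEvent ends a₁ a₂)ᶜ))) :
    0 ≤ -(prob (Function.update p e₂ 1) (connEvent ends a₁ a₂)ᶜ *
        (y₁ * prob (Function.update p e₂ 0) (connEvent ends a₁ b ∩ connEvent ends a₁ a₃ ∩
            connEvent ends a₂ o ∩ (connEvent ends a₁ a₂)ᶜ) -
          y₀ * prob (Function.update p e₂ 0) (connEvent ends a₁ a₃ ∩ connEvent ends a₂ o ∩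
            (connEvent ends a₁ a₂)ᶜ))) +
        Dqo (Function.update p e₂ 1) ends o a₁ a₂ *
        (y₁ * prob (Function.update p e₂ 0) (connEvent ends a₁ b ∩ connEvent ends a₁ a₃ ∩
            (connEvent ends a₁ a₂)ᶜ) -
          y₀ * prob (Function.update p e₂ 0) (connEvent ends a₁ a₃ ∩ (connEvent ends a₁ a₂)ᶜ)) := by
  set p₀ := Function.update p e₂ 0 with hp₀
  set p₁ := Function.update p e₂ 1 with hp₁
  have hp0 : IsProbVec p₀ := hp.update e₂ le_rfl zero_le_one
  have hp1 : IsProbVec p₁ := hp.update e₂ zero_le_one le_rfl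
  set Av := y₁ * prob p₀ (connEvent ends a₁ b ∩ connEvent ends a₁ a₃ ∩ connEvent ends a₂ o ∩
      (connEvent ends a₁ a₂)ᶜ) -
    y₀ * prob p₀ (connEvent ends a₁ a₃ ∩ connEvent ends a₂ o ∩ (connEvent ends a₁ a₂)ᶜ) with hAv
  set Bv := y₁ * prob p₀ (connEvent ends a₁ b ∩ connEvent ends a₁ a₃ ∩ (connEvent ends a₁ a₂)ᶜ) -
    y₀ * prob p₀ (connEvent ends a₁ a₃ ∩ (connEvent ends a₁ a₂)ᶜ) with hBv
  have hD : 0 ≤ Dpd p₀ ends a₁ a₂ a₃ := prob_nonneg hp0 _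
  have hX1 : 0 ≤ prob p₁ (connEvent ends a₁ a₂)ᶜ := prob_nonneg hp1 _
  have hcoef : 0 ≤ Dqo p₁ ends o a₁ a₂ * Dpd p₀ ends a₁ a₂ a₃ -
      Dpdo p₀ ends o a₁ a₂ a₃ * prob p₁ (connEvent ends a₁ a₂)ᶜ := sub_nonneg.mpr hodds
  -- `D₀ · Λᴵ(c¹, y) = X₁ · Λᴵ(PD₀, y) + (D₀ U₁ − D₀ₒ X₁) · Bᴵ(y)`
  have key : Dpd p₀ ends a₁ a₂ a₃ *
      (-(prob p₁ (connEvent ends a₁ a₂)ᶜ * Av) + Dqo p₁ ends o a₁ a₂ * Bv) =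
      prob p₁ (connEvent ends a₁ a₂)ᶜ *
        (-(Dpd p₀ ends a₁ a₂ a₃ * Av) + Dpdo p₀ ends o a₁ a₂ a₃ * Bv) +
        (Dqo p₁ ends o a₁ a₂ * Dpd p₀ ends a₁ a₂ a₃ -
          Dpdo p₀ ends o a₁ a₂ a₃ * prob p₁ (connEvent ends a₁ a₂)ᶜ) * Bv := by
    ring
  have hrhs : 0 ≤ prob p₁ (connEvent ends a₁ a₂)ᶜ *
        (-(Dpd p₀ ends a₁ a₂ a₃ * Av) + Dpdo p₀ ends o a₁ a₂ a₃ * Bv) +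
        (Dqo p₁ ends o a₁ a₂ * Dpd p₀ ends a₁ a₂ a₃ -
          Dpdo p₀ ends o a₁ a₂ a₃ * prob p₁ (connEvent ends a₁ a₂)ᶜ) * Bv :=
    add_nonneg (mul_nonneg hX1 hΛ) (mul_nonneg hcoef hB)
  rw [← key] at hrhs
  rcases eq_or_lt_of_le hD with hD0 | hDpos
  · have hff := pT1_mul_pT_le_Dpd (ends := ends) (a₁ := a₁) (a₂ := a₂) (a₃ := a₃) p₀ hp0
    rw [← hD0] at hff
    have hT1 : 0 ≤ prob p₀ (connEvent ends a₁ a₃ ∩ (connEvent ends a₁ a₂)ᶜ) := prob_nonneg hp0 _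
    have hT2 : 0 ≤ prob p₀ (connEvent ends a₂ a₃ ∩ (connEvent ends a₁ a₂)ᶜ) := prob_nonneg hp0 _
    rcases eq_or_lt_of_le hT1 with h1 | h1
    · have hz : ∀ Y : Set (Config E), Y ⊆ connEvent ends a₁ a₃ ∩ (connEvent ends a₁ a₂)ᶜ →
          prob p₀ Y = 0 := fun Y hY =>
        le_antisymm (by rw [h1]; exact prob_mono hp0 hY) (prob_nonneg hp0 Y)
      have z4 : prob p₀ (connEvent ends a₁ b ∩ connEvent ends a₁ a₃ ∩ connEvent ends a₂ o ∩
          (connEvent ends a₁ a₂)ᶜ) = 0 := hz _ (fun _ h => ⟨h.1.1.2, h.2⟩)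
      have z3 : prob p₀ (connEvent ends a₁ a₃ ∩ connEvent ends a₂ o ∩ (connEvent ends a₁ a₂)ᶜ) = 0 :=
        hz _ (fun _ h => ⟨h.1.1, h.2⟩)
      have z2 : prob p₀ (connEvent ends a₁ b ∩ connEvent ends a₁ a₃ ∩ (connEvent ends a₁ a₂)ᶜ) = 0 :=
        hz _ (fun _ h => ⟨h.1.2, h.2⟩)
      have z1 : prob p₀ (connEvent ends a₁ a₃ ∩ (connEvent ends a₁ a₂)ᶜ) = 0 := hz _ (fun _ h => h)
      rw [hAv, hBv, z4, z3, z2, z1]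
      simp
    · have h2 : prob p₀ (connEvent ends a₂ a₃ ∩ (connEvent ends a₁ a₂)ᶜ) = 0 := by
        by_contra hne
        have h2pos : 0 < prob p₀ (connEvent ends a₂ a₃ ∩ (connEvent ends a₁ a₂)ᶜ) :=
          lt_of_le_of_ne hT2 (Ne.symm hne)
        linarith [mul_pos h1 h2pos]
      have hX1z : prob p₁ (connEvent ends a₁ a₂)ᶜ = 0 := by
        rw [hp₁, prob_Q_update_one_eq_Dpd_add (a₁ := a₁) p he, ← hp₀, ← hD0, h2, add_zero]
      have hU1z : Dqo p₁ ends o a₁ a₂ = 0 := by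
        refine le_antisymm ?_ (prob_nonneg hp1 _)
        rw [← hX1z]
        unfold Dqo
        exact prob_mono hp1 (fun _ h => h.2)
      rw [hX1z, hU1z]
      simp
  · exact nonneg_of_mul_nonneg_right hrhs hDpos

omit [Fintype V] [DecidableEq V] in
/-- **The forced-open `o`-pair dominates the Q pair of `G − e₂` in every `(i)`-type form.** -/
theorem lamQI_c1_nonneg_ofQ (p : E → R) (hp : IsProbVec p) (o b : V)
    (hq : Dqo (Function.update p e₂ 0) ends o a₁ a₂ *
        prob (Function.update p e₂ 1) (connEvent ends a₁ a₂)ᶜ ≤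
      Dqo (Function.update p e₂ 1) ends o a₁ a₂ * prob (Function.update p e₂ 0) (connEvent ends a₁ a₂)ᶜ)
    (y₀ y₁ : R)
    (hB : 0 ≤ y₁ * prob (Function.update p e₂ 0) (connEvent ends a₁ b ∩ connEvent ends a₁ a₃ ∩
        (connEvent ends a₁ a₂)ᶜ) -
      y₀ * prob (Function.update p e₂ 0) (connEvent ends a₁ a₃ ∩ (connEvent ends a₁ a₂)ᶜ))
    (hΛ : 0 ≤ -(prob (Function.update p e₂ 0) (connEvent ends a₁ a₂)ᶜ *
        (y₁ * prob (Function.update p e₂ 0) (connEvent ends a₁ b ∩ connEvent ends a₁ a₃ ∩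
            connEvent ends a₂ o ∩ (connEvent ends a₁ a₂)ᶜ) -
          y₀ * prob (Function.update p e₂ 0) (connEvent ends a₁ a₃ ∩ connEvent ends a₂ o ∩
            (connEvent ends a₁ a₂)ᶜ))) +
        Dqo (Function.update p e₂ 0) ends o a₁ a₂ *
        (y₁ * prob (Function.update p e₂ 0) (connEvent ends a₁ b ∩ connEvent ends a₁ a₃ ∩
            (connEvent ends a₁ a₂)ᶜ) -
          y₀ * prob (Function.update p e₂ 0) (connEvent ends a₁ a₃ ∩ (connEvent ends a₁ a₂)ᶜ))) :
    0 ≤ -(prob (Function.update p e₂ 1) (connEvent ends a₁ a₂)ᶜ *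
        (y₁ * prob (Function.update p e₂ 0) (connEvent ends a₁ b ∩ connEvent ends a₁ a₃ ∩
            connEvent ends a₂ o ∩ (connEvent ends a₁ a₂)ᶜ) -
          y₀ * prob (Function.update p e₂ 0) (connEvent ends a₁ a₃ ∩ connEvent ends a₂ o ∩
            (connEvent ends a₁ a₂)ᶜ))) +
        Dqo (Function.update p e₂ 1) ends o a₁ a₂ *
        (y₁ * prob (Function.update p e₂ 0) (connEvent ends a₁ b ∩ connEvent ends a₁ a₃ ∩
            (connEvent ends a₁ a₂)ᶜ) -
          y₀ * prob (Function.update p e₂ 0) (connEvent ends a₁ a₃ ∩ (connEvent ends a₁ a₂)ᶜ)) := by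
  set p₀ := Function.update p e₂ 0 with hp₀
  set p₁ := Function.update p e₂ 1 with hp₁
  have hp0 : IsProbVec p₀ := hp.update e₂ le_rfl zero_le_one
  have hp1 : IsProbVec p₁ := hp.update e₂ zero_le_one le_rfl
  set Av := y₁ * prob p₀ (connEvent ends a₁ b ∩ connEvent ends a₁ a₃ ∩ connEvent ends a₂ o ∩
      (connEvent ends a₁ a₂)ᶜ) -
    y₀ * prob p₀ (connEvent ends a₁ a₃ ∩ connEvent ends a₂ o ∩ (connEvent ends a₁ a₂)ᶜ) with hAv
  set Bv := y₁ * prob p₀ (connEvent ends a₁ b ∩ connEvent ends a₁ a₃ ∩ (connEvent ends a₁ a₂)ᶜ) -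
    y₀ * prob p₀ (connEvent ends a₁ a₃ ∩ (connEvent ends a₁ a₂)ᶜ) with hBv
  have hX0 : 0 ≤ prob p₀ (connEvent ends a₁ a₂)ᶜ := prob_nonneg hp0 _
  have hX1 : 0 ≤ prob p₁ (connEvent ends a₁ a₂)ᶜ := prob_nonneg hp1 _
  have hcoef : 0 ≤ Dqo p₁ ends o a₁ a₂ * prob p₀ (connEvent ends a₁ a₂)ᶜ -
      Dqo p₀ ends o a₁ a₂ * prob p₁ (connEvent ends a₁ a₂)ᶜ := sub_nonneg.mpr hq
  have key : prob p₀ (connEvent ends a₁ a₂)ᶜ *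
      (-(prob p₁ (connEvent ends a₁ a₂)ᶜ * Av) + Dqo p₁ ends o a₁ a₂ * Bv) =
      prob p₁ (connEvent ends a₁ a₂)ᶜ *
        (-(prob p₀ (connEvent ends a₁ a₂)ᶜ * Av) + Dqo p₀ ends o a₁ a₂ * Bv) +
        (Dqo p₁ ends o a₁ a₂ * prob p₀ (connEvent ends a₁ a₂)ᶜ -
          Dqo p₀ ends o a₁ a₂ * prob p₁ (connEvent ends a₁ a₂)ᶜ) * Bv := by
    ring
  have hrhs : 0 ≤ prob p₁ (connEvent ends a₁ a₂)ᶜ *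
        (-(prob p₀ (connEvent ends a₁ a₂)ᶜ * Av) + Dqo p₀ ends o a₁ a₂ * Bv) +
        (Dqo p₁ ends o a₁ a₂ * prob p₀ (connEvent ends a₁ a₂)ᶜ -
          Dqo p₀ ends o a₁ a₂ * prob p₁ (connEvent ends a₁ a₂)ᶜ) * Bv :=
    add_nonneg (mul_nonneg hX1 hΛ) (mul_nonneg hcoef hB)
  rw [← key] at hrhs
  rcases eq_or_lt_of_le hX0 with hX0' | hX0'
  · have hz : ∀ Y : Set (Config E), Y ⊆ (connEvent ends a₁ a₂)ᶜ → prob p₀ Y = 0 := fun Y hY =>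
      le_antisymm (by rw [hX0']; exact prob_mono hp0 hY) (prob_nonneg hp0 Y)
    have z4 : prob p₀ (connEvent ends a₁ b ∩ connEvent ends a₁ a₃ ∩ connEvent ends a₂ o ∩
        (connEvent ends a₁ a₂)ᶜ) = 0 := hz _ (fun _ h => h.2)
    have z3 : prob p₀ (connEvent ends a₁ a₃ ∩ connEvent ends a₂ o ∩ (connEvent ends a₁ a₂)ᶜ) = 0 :=
      hz _ (fun _ h => h.2)
    have z2 : prob p₀ (connEvent ends a₁ b ∩ connEvent ends a₁ a₃ ∩ (connEvent ends a₁ a₂)ᶜ) = 0 :=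
      hz _ (fun _ h => h.2)
    have z1 : prob p₀ (connEvent ends a₁ a₃ ∩ (connEvent ends a₁ a₂)ᶜ) = 0 := hz _ (fun _ h => h.2)
    rw [hAv, hBv, z4, z3, z2, z1]
    simp
  · exact nonneg_of_mul_nonneg_right hrhs hX0'

/-- **`(i-Q)` lifts along an `a₂a₃`-edge under the threshold domination.** -/
theorem zSplitIQ_of_a2_edge (p : E → R) (hp : IsProbVec p) (he : ends e₂ = s(a₂, a₃)) (o b : V)
    (hdom : Dpdo (Function.update p e₂ 0) ends o a₁ a₂ a₃ *
        prob (Function.update p e₂ 1) (connEvent ends a₁ a₂)ᶜ ≤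
      Dqo (Function.update p e₂ 1) ends o a₁ a₂ * Dpd (Function.update p e₂ 0) ends a₁ a₂ a₃ ∨
      Dqo (Function.update p e₂ 0) ends o a₁ a₂ *
        prob (Function.update p e₂ 1) (connEvent ends a₁ a₂)ᶜ ≤
      Dqo (Function.update p e₂ 1) ends o a₁ a₂ * prob (Function.update p e₂ 0) (connEvent ends a₁ a₂)ᶜ)
    (hI : ZSplitI (Function.update p e₂ 0) ends o a₁ a₂ a₃ b)
    (hQ : ZSplitIQ (Function.update p e₂ 0) ends o a₁ a₂ a₃ b) :
    ZSplitIQ p ends o a₁ a₂ a₃ b := by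
  unfold ZSplitIQ
  rw [iExprQ_a2_edge p he o b]
  have hr0 : 0 ≤ p e₂ := hp.nonneg e₂
  have hr1 : 0 ≤ 1 - p e₂ := by linarith [hp.le_one e₂]
  have hp0 : IsProbVec (Function.update p e₂ 0) := hp.update e₂ le_rfl zero_le_one
  have c00 : 0 ≤ iExprT (Function.update p e₂ 0) ends o a₁ a₂ a₃ b
      (Dqo (Function.update p e₂ 0) ends o a₁ a₂) (prob (Function.update p e₂ 0) (connEvent ends a₁ a₂)ᶜ) := hQ
  have c01 := lamQI_c0_y1_nonneg p hp he o b hQ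
  have hIe : 0 ≤ -(Dpd (Function.update p e₂ 0) ends a₁ a₂ a₃ *
      (prob (Function.update p e₂ 0) (connEvent ends a₁ a₂)ᶜ *
        prob (Function.update p e₂ 0) (connEvent ends a₁ b ∩ connEvent ends a₁ a₃ ∩
          connEvent ends a₂ o ∩ (connEvent ends a₁ a₂)ᶜ) -
      prob (Function.update p e₂ 0) (connEvent ends a₁ b ∩ (connEvent ends a₁ a₂)ᶜ) *
        prob (Function.update p e₂ 0) (connEvent ends a₁ a₃ ∩ connEvent ends a₂ o ∩
          (connEvent ends a₁ a₂)ᶜ))) +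
      Dpdo (Function.update p e₂ 0) ends o a₁ a₂ a₃ *
      (prob (Function.update p e₂ 0) (connEvent ends a₁ a₂)ᶜ *
        prob (Function.update p e₂ 0) (connEvent ends a₁ b ∩ connEvent ends a₁ a₃ ∩
          (connEvent ends a₁ a₂)ᶜ) -
      prob (Function.update p e₂ 0) (connEvent ends a₁ b ∩ (connEvent ends a₁ a₂)ᶜ) *
        prob (Function.update p e₂ 0) (connEvent ends a₁ a₃ ∩ (connEvent ends a₁ a₂)ᶜ)) := by
    have := hI
    unfold ZSplitI at this
    rw [iExpr_eq_iExprT, iExprT_eq] at this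
    exact this
  have hQe : 0 ≤ -(prob (Function.update p e₂ 0) (connEvent ends a₁ a₂)ᶜ *
      (prob (Function.update p e₂ 0) (connEvent ends a₁ a₂)ᶜ *
        prob (Function.update p e₂ 0) (connEvent ends a₁ b ∩ connEvent ends a₁ a₃ ∩
          connEvent ends a₂ o ∩ (connEvent ends a₁ a₂)ᶜ) -
      prob (Function.update p e₂ 0) (connEvent ends a₁ b ∩ (connEvent ends a₁ a₂)ᶜ) *
        prob (Function.update p e₂ 0) (connEvent ends a₁ a₃ ∩ connEvent ends a₂ o ∩
          (connEvent ends a₁ a₂)ᶜ))) +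
      Dqo (Function.update p e₂ 0) ends o a₁ a₂ *
      (prob (Function.update p e₂ 0) (connEvent ends a₁ a₂)ᶜ *
        prob (Function.update p e₂ 0) (connEvent ends a₁ b ∩ connEvent ends a₁ a₃ ∩
          (connEvent ends a₁ a₂)ᶜ) -
      prob (Function.update p e₂ 0) (connEvent ends a₁ b ∩ (connEvent ends a₁ a₂)ᶜ) *
        prob (Function.update p e₂ 0) (connEvent ends a₁ a₃ ∩ (connEvent ends a₁ a₂)ᶜ)) := by
    have := hQ
    unfold ZSplitIQ at this
    rw [iExprT_eq] at this
    exact this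
  have c10 : 0 ≤ -(prob (Function.update p e₂ 1) (connEvent ends a₁ a₂)ᶜ *
      (prob (Function.update p e₂ 0) (connEvent ends a₁ a₂)ᶜ *
        prob (Function.update p e₂ 0) (connEvent ends a₁ b ∩ connEvent ends a₁ a₃ ∩
          connEvent ends a₂ o ∩ (connEvent ends a₁ a₂)ᶜ) -
      prob (Function.update p e₂ 0) (connEvent ends a₁ b ∩ (connEvent ends a₁ a₂)ᶜ) *
        prob (Function.update p e₂ 0) (connEvent ends a₁ a₃ ∩ connEvent ends a₂ o ∩
          (connEvent ends a₁ a₂)ᶜ))) +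
      Dqo (Function.update p e₂ 1) ends o a₁ a₂ *
      (prob (Function.update p e₂ 0) (connEvent ends a₁ a₂)ᶜ *
        prob (Function.update p e₂ 0) (connEvent ends a₁ b ∩ connEvent ends a₁ a₃ ∩
          (connEvent ends a₁ a₂)ᶜ) -
      prob (Function.update p e₂ 0) (connEvent ends a₁ b ∩ (connEvent ends a₁ a₂)ᶜ) *
        prob (Function.update p e₂ 0) (connEvent ends a₁ a₃ ∩ (connEvent ends a₁ a₂)ᶜ)) := by
    rcases hdom with hodds | hq
    · exact lamQI_c1_nonneg p hp he o b hodds _ _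
        (bhk13_cleared (ends := ends) (a₁ := a₁) (a₂ := a₂) (a₃ := a₃) _ hp0 b) hIe
    · exact lamQI_c1_nonneg_ofQ p hp o b hq _ _
        (bhk13_cleared (ends := ends) (a₁ := a₁) (a₂ := a₂) (a₃ := a₃) _ hp0 b) hQe
  have c11 : 0 ≤ -(prob (Function.update p e₂ 1) (connEvent ends a₁ a₂)ᶜ *
      (prob (Function.update p e₂ 1) (connEvent ends a₁ a₂)ᶜ *
        prob (Function.update p e₂ 0) (connEvent ends a₁ b ∩ connEvent ends a₁ a₃ ∩
          connEvent ends a₂ o ∩ (connEvent ends a₁ a₂)ᶜ) -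
      prob (Function.update p e₂ 1) (connEvent ends a₁ b ∩ (connEvent ends a₁ a₂)ᶜ) *
        prob (Function.update p e₂ 0) (connEvent ends a₁ a₃ ∩ connEvent ends a₂ o ∩
          (connEvent ends a₁ a₂)ᶜ))) +
      Dqo (Function.update p e₂ 1) ends o a₁ a₂ *
      (prob (Function.update p e₂ 1) (connEvent ends a₁ a₂)ᶜ *
        prob (Function.update p e₂ 0) (connEvent ends a₁ b ∩ connEvent ends a₁ a₃ ∩
          (connEvent ends a₁ a₂)ᶜ) -
      prob (Function.update p e₂ 1) (connEvent ends a₁ b ∩ (connEvent ends a₁ a₂)ᶜ) *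
        prob (Function.update p e₂ 0) (connEvent ends a₁ a₃ ∩ (connEvent ends a₁ a₂)ᶜ)) := by
    rcases hdom with hodds | hq
    · exact lamQI_c1_nonneg p hp he o b hodds _ _ (bhk13_forced_open p hp he b)
        (a2MixI_nonneg p hp he o b hI)
    · exact lamQI_c1_nonneg_ofQ p hp o b hq _ _ (bhk13_forced_open p hp he b) c01
  have hmid := add_nonneg c01 c10
  exact mul_nonneg hr1 (add_nonneg (add_nonneg (mul_nonneg (pow_nonneg hr1 2) c00)
    (mul_nonneg (mul_nonneg hr0 hr1) hmid)) (mul_nonneg (pow_nonneg hr0 2) c11))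

/-- **The four forms lift along an `a₂a₃`-edge under the threshold domination**: if the
forced-open `o`-pair dominates the PD pair or the Q pair of `G − e₂`, the four forms of `G − e₂` give
the four forms of `G`. -/
theorem fourForms_of_a2_edge (p : E → R) (hp : IsProbVec p) (he : ends e₂ = s(a₂, a₃)) (o b : V)
    (hdom : Dpdo (Function.update p e₂ 0) ends o a₁ a₂ a₃ *
        prob (Function.update p e₂ 1) (connEvent ends a₁ a₂)ᶜ ≤
      Dqo (Function.update p e₂ 1) ends o a₁ a₂ * Dpd (Function.update p e₂ 0) ends a₁ a₂ a₃ ∨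
      Dqo (Function.update p e₂ 0) ends o a₁ a₂ *
        prob (Function.update p e₂ 1) (connEvent ends a₁ a₂)ᶜ ≤
      Dqo (Function.update p e₂ 1) ends o a₁ a₂ * prob (Function.update p e₂ 0) (connEvent ends a₁ a₂)ᶜ)
    (h : FourForms (Function.update p e₂ 0) ends o a₁ a₂ a₃ b) : FourForms p ends o a₁ a₂ a₃ b := by
  obtain ⟨hII, hIIQ, hI, hIQ⟩ := h
  exact ⟨zSplitII_of_a2_edge p hp he o b hII, zSplitIIQ_of_a2_edge p hp he o b hdom hII hIIQ,
    zSplitI_of_a2_edge p hp he o b hI, zSplitIQ_of_a2_edge p hp he o b hdom hI hIQ⟩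

end IQ

end CaseOne

end Summit.Ventures.PercRepro2
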